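import Literature.Computability.Complexity.Williams2014PreprocCopies
import Literature.Computability.Complexity.Williams2014AccSatAssembly
import Literature.Computability.Complexity.YatesMachineFinal
import Literature.Computability.Complexity.StackMachinesTM2
import HarnessLib

/-!
# The preprocessing machine of Williams' Theorem 4.1, III: output, assembly, running time

Literature / circuit complexity, the last file of the series `Williams2014PreprocSpec` (the
closed form `orCodeList` of the code of the OR of restrictions) → `Williams2014PreprocMachine`
(bank, header, parameters) → `Williams2014PreprocCopies` (the copies and the final gate) → this
file, for R. Williams, *Nonuniform ACC circuit lower bounds*, J. ACM 61 (2014), proof of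
Thm. 4.1 ("`C'` … is obtained by producing `2^ℓ` copies of `C`, plugging in a different possible
assignment to the first `ℓ` inputs of `C` in each copy, and taking the OR"):

* `finishProg` / `runs_finishProg`: the reversed output is poured onto `out`, the unary length
  item is prepended (two pushes and one `1`-pair per counted item), the parameter registers
  are cleared;
* `preprocProg r` / `runs_preprocProg`: the whole machine maps the file with
  `encodeAccCircuit m C` on `inp` to the file with `encodeAccCircuit m (C.orRestrictions ℓ)` on
  `out`, `ℓ = ellOf r n`, everything else empty (`circuitCodeList_orRestrictions`,
  `encodingListNatBool_encode_eq_encList`);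
* `machine r` (compiled to Mathlib's `TM2` model by `StackMachinesTM2.lean`),
  `machine_outputsWithin`, and the running time `totalCost ≤ cst r · Z⁵`,
  `Z = 2^ℓ (n + s + fan-in + 2)` (`totalCost_le`);
* the sandwich `ellOf_sandwich` (`ⁿ√n ≤ 2 ℓ + 2`, `ℓ ≤ ⁿ√n`);
* **`Williams2014_preprocessing`**: the hypothesis `hP` of `Williams2014_thm_4_1_of_machines`
  for `ℓ = ellOf`; hence **`Williams2014_thm_4_1_of_lemma_4_1`** and
  **`Williams2014_accSat_polysize_of_lemma_4_1`**: with the evaluation machine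
  (`Williams2014_lemma_4_2_strong`, `YatesMachineFinal.lean`) and this preprocessing machine,
  Williams' Theorem 4.1 and its polynomial-size corollary follow from the conversion lemma
  `Williams2014_lemma_4_1` (Beigel–Tarui made algorithmic) ALONE.

## References

* R. Williams, *Nonuniform ACC circuit lower bounds*, J. ACM 61(1) (2014) 2:1–2:32, Thm. 4.1
  and its proof, p. 18 [Williams2014].
* S. Arora, B. Barak, *Computational Complexity: A Modern Approach*, CUP 2009, §0.1, §1.3
  [AroraBarak2009].
-/

namespace Literature.Computability.Complexity

open SProg Com _root_.Computability GateList MetaComplexity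

namespace PreprocP

open PRF

variable {n : ℕ}

/-! ### Phase 5: the output -/

/-- The unary length item: two `1`s on `out` per token of `cnt`. [folklore] -/
def unaryLoop : Com PReg := loop pcnt (push pout true ;; push pout true) (push pout true ;; push pout true)

/-- Effect of `unaryLoop`: `out := 1^{2k} ++ out`, `cnt` emptied, `4 k + 1` steps. [folklore] -/
theorem runs_unaryLoop : ∀ (k : ℕ) (σ : PRF), σ.cnt = List.replicate k true →
    Runs unaryLoop (base σ.regs) (base { σ with cnt := [], out := List.replicate (2 * k) true ++ σ.out }.regs) (4 * k + 1)
  | 0, σ, hcnt => by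
    simp only [List.replicate_zero] at hcnt
    refine (Runs.loop_nil _ _ (by simp [hcnt])).of_eq ?_ (by simp)
    simp only [Nat.mul_zero, List.replicate_zero, List.nil_append]
    rw [← hcnt]
  | k + 1, σ, hcnt => by
    set σ₀ : PRF := { σ with cnt := List.replicate k true } with hσ₀
    set σ₁ : PRF := { σ₀ with out := true :: true :: σ.out } with hσ₁
    have hb : Runs (push pout true ;; push pout true) (base σ₀.regs) (base σ₁.regs) 2 := by
      refine ((Runs.opush (β := POwn) .out true σ₀.regs).seq (Runs.opush (β := POwn) .out true _)).of_eq ?_ (by rfl)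
      simp only [hσ₁, hσ₀]; simp
    have ih := runs_unaryLoop k σ₁ (by simp [hσ₁, hσ₀])
    have hk : (base σ.regs) pcnt = true :: List.replicate k true := by simp [hcnt, List.replicate_succ]
    refine (Runs.loop_true' hk (by simp [hσ₀]) hb ih).of_eq ?_ (by omega)
    simp only [hσ₁, hσ₀, Nat.mul_succ, List.replicate_add]; simp

/-- `cleanupProg`: clear the parameter registers still holding data. [folklore] -/
def cleanupProg : Com PReg :=
  clear pinp ;; (clear pTO ;; (clear pVO ;; (clear pSS ;; (clear pEL ;; (clear pEu ;; (clear pA ;; clear pAW))))))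

/-- Effect of `cleanupProg`, in time linear in the cleared contents. [folklore] -/
theorem runs_cleanupProg (σ : PRF) :
    Runs cleanupProg (base σ.regs)
      (base { σ with inp := [], TO := [], VO := [], SS := [], EL := [], Eu := [], A := [], AW := [] }.regs)
      (2 * (σ.inp.length + σ.TO.length + σ.VO.length + σ.SS.length + σ.EL.length + σ.Eu.length + σ.A.length +
        σ.AW.length) + 8) := by
  have h1 := runs_oclear (β := POwn) .inp σ.regs
  set T1 := Function.update σ.regs .inp [] with hT1
  have h2 := runs_oclear (β := POwn) .TO T1
  set T2 := Function.update T1 .TO [] with hT2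
  have h3 := runs_oclear (β := POwn) .VO T2
  set T3 := Function.update T2 .VO [] with hT3
  have h4 := runs_oclear (β := POwn) .SS T3
  set T4 := Function.update T3 .SS [] with hT4
  have h5 := runs_oclear (β := POwn) .EL T4
  set T5 := Function.update T4 .EL [] with hT5
  have h6 := runs_oclear (β := POwn) .Eu T5
  set T6 := Function.update T5 .Eu [] with hT6
  have h7 := runs_oclear (β := POwn) .A T6
  set T7 := Function.update T6 .A [] with hT7
  have h8 := runs_oclear (β := POwn) .AW T7
  refine (h1.seq (h2.seq (h3.seq (h4.seq (h5.seq (h6.seq (h7.seq h8))))))).of_eq ?_ ?_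
  · simp only [hT7, hT6, hT5, hT4, hT3, hT2, hT1]; simp
  · simp only [hT7, hT6, hT5, hT4, hT3, hT2, hT1]
    simp
    omega

/-- `finishProg`: pour the reversed output onto `out`, prepend the unary length item (the
separator `01` then `1^{2k}`), clean up. [folklore] -/
def finishProg : Com PReg :=
  pour po pout ;; (push pout true ;; (push pout false ;; (unaryLoop ;; cleanupProg)))

/-- `1ᵏ` is Mathlib's unary numeral. [folklore] -/
theorem unaryEncodeNat_eq_replicate : ∀ k : ℕ, unaryEncodeNat k = List.replicate k true
  | 0 => rfl
  | k + 1 => by rw [unaryEncodeNat, unaryEncodeNat_eq_replicate k, List.replicate_succ]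

/-- Doubling a block of ones. [folklore] -/
theorem dbl_replicate_true (k : ℕ) : dbl (List.replicate k true) = List.replicate (2 * k) true := by
  induction k with
  | zero => rfl
  | succ k ih => rw [List.replicate_succ, dbl_cons, ih, Nat.mul_succ, List.replicate_add]; simp

/-- **Effect of the output phase**: `out := encList (1^{|E|} :: E)`, the library code of the
list of naturals whose numerals are `E`; all other registers used by the machine are cleared.
[folklore] -/
theorem runs_finishProg (E : List (List Bool)) (σ : PRF) (ho : σ.o = outRev E)
    (hcnt : σ.cnt = List.replicate E.length true) (hout : σ.out = []) :
    Runs finishProg (base σ.regs)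
      (base { σ with
        o := [], cnt := [], out := encList (List.replicate E.length true :: E)
        inp := [], TO := [], VO := [], SS := [], EL := [], Eu := [], A := [], AW := [] }.regs)
      ((3 * (outRev E).length + 1) + 1 + 1 + (4 * E.length + 1) +
        (2 * (σ.inp.length + σ.TO.length + σ.VO.length + σ.SS.length + σ.EL.length + σ.Eu.length + σ.A.length +
          σ.AW.length) + 8)) := by
  set σ₁ : PRF := { σ with o := [], out := encList E } with hσ₁
  have h1 : Runs (pour po pout) (base σ.regs) (base σ₁.regs) (3 * (outRev E).length + 1) := by
    have h := runs_opour (β := POwn) (a := .o) (b := .out) (by decide) σ.regs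
    refine h.of_eq ?_ (by simp [ho])
    simp only [hσ₁]; simp [ho, hout, reverse_outRev]
  set σ₂ : PRF := { σ with o := [], out := true :: encList E } with hσ₂
  have h2 : Runs (push pout true) (base σ₁.regs) (base σ₂.regs) 1 :=
    (Runs.opush (β := POwn) .out true σ₁.regs).of_eq (by simp only [hσ₂, hσ₁]; simp) le_rfl
  set σ₃ : PRF := { σ with o := [], out := false :: true :: encList E } with hσ₃
  have h3 : Runs (push pout false) (base σ₂.regs) (base σ₃.regs) 1 :=
    (Runs.opush (β := POwn) .out false σ₂.regs).of_eq (by simp only [hσ₃, hσ₂]; simp) le_rfl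
  set σ₄ : PRF := { σ with o := [], cnt := [], out := encList (List.replicate E.length true :: E) } with hσ₄
  have h4 : Runs unaryLoop (base σ₃.regs) (base σ₄.regs) (4 * E.length + 1) := by
    refine (runs_unaryLoop E.length σ₃ (by simp [hσ₃, hcnt])).of_eq ?_ le_rfl
    simp only [hσ₄, hσ₃, encList_cons_eq_dbl, dbl_replicate_true]
  have h5 := runs_cleanupProg σ₄
  refine (h1.seq (h2.seq (h3.seq (h4.seq h5)))).of_eq ?_ ?_
  · simp only [hσ₄]
  · simp only [hσ₄]; omega

/-! ### The word of the copy index before the copies -/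

/-- `initWordProg`: `AW := 0^ℓ`, the word of the copy index `0`. [folklore] -/
def initWordProg : Com PReg := copy pEu pU2 (ra .t) (ra .u) ;; (fillFalse pAW pU2 ptk ;; clear ptk)

/-- Effect of `initWordProg`. [folklore] -/
theorem runs_initWordProg (ℓ : ℕ) (σ : PRF) (hEu : σ.Eu = List.replicate ℓ true) (hAW : σ.AW = [])
    (hU2 : σ.U2 = []) (htk : σ.tk = []) :
    Runs initWordProg (base σ.regs) (base { σ with AW := natToWord ℓ 0 }.regs) ((10 * ℓ + 3) + (4 * ℓ + 1) + (2 * ℓ + 1)) := by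
  set σ₁ : PRF := { σ with U2 := List.replicate ℓ true } with hσ₁
  have h1 : Runs (copy pEu pU2 (ra .t) (ra .u)) (base σ.regs) (base σ₁.regs) (10 * ℓ + 3) := by
    have h := runs_ocopy (β := POwn) (a := .Eu) (b := .U2) (by decide) σ.regs
    refine h.of_eq ?_ (by simp [hEu])
    simp only [hσ₁]; simp [hEu, hU2]
  set σ₂ : PRF := { σ with AW := natToWord ℓ 0, tk := List.replicate ℓ true } with hσ₂
  have h2 : Runs (fillFalse pAW pU2 ptk) (base σ₁.regs) (base σ₂.regs) (4 * ℓ + 1) := by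
    have h := runs_fillFalse (A := pAW) (U := pU2) (V := ptk) (by decide) (by decide) (by decide) ℓ (base σ₁.regs)
      (by simp [hσ₁])
    refine h.of_eq ?_ le_rfl
    simp only [hσ₂, hσ₁, natToWord_zero]; simp [hAW, htk, hU2]
  have h3 : Runs (clear ptk) (base σ₂.regs) (base { σ with AW := natToWord ℓ 0 }.regs) (2 * ℓ + 1) := by
    refine (runs_clear ptk (base σ₂.regs)).of_eq ?_ (by simp [hσ₂])
    simp only [hσ₂]; simp [← htk]
  exact (h1.seq (h2.seq h3)).of_eq rfl (by omega)

/-! ### The whole machine -/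

/-- **The preprocessing machine** `P` for the parameter `r`: header, parameters, header of the
output, the word of the copy index, the `2^ℓ` copies, the final gate, the output.
[cite: Williams2014, Thm. 4.1] -/
def preprocProg (r : ℕ) : Com PReg :=
  headerProg ;; (paramsProg r ;; (emitHeaderProg ;; (initWordProg ;; (copiesProg ;; (finalGateProg ;; finishProg)))))

/-- The numerals finally emitted: the numerals of `orCodeList m C ℓ`. [folklore] -/
theorem emitted_eq (m : ℕ) (C : Circuit (Fin n)) (ℓ : ℕ) :
    [encodeNat (n - ℓ), encodeNat 1, encodeNat (2 ^ ℓ * (C.size + 2)), encodeNat (2 ^ ℓ * (C.size + 2) + 1)] ++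
      ((List.range (2 ^ ℓ)).flatMap (copyBlock m C ℓ)).map encodeNat ++
      [encodeNat (accCode m (GateFn.or (2 ^ ℓ))), encodeNat (2 ^ ℓ)] ++
      ((List.range (2 ^ ℓ)).flatMap fun a => copyWire ℓ (a * (C.size + 2)) a C.output).map encodeNat =
    (orCodeList m C ℓ).map encodeNat := by
  simp [orCodeList]

/-- The code of the output circuit in terms of the emitted numerals. [folklore] -/
theorem encodeAccCircuit_orRestrictions (m : ℕ) (C : Circuit (Fin n)) (ℓ : ℕ) :
    encodeAccCircuit m (C.orRestrictions ℓ) =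
      encList (List.replicate ((orCodeList m C ℓ).map encodeNat).length true :: (orCodeList m C ℓ).map encodeNat) := by
  rw [encodeAccCircuit, circuitCodeList_orRestrictions, encodingListNatBool_encode_eq_encList,
    unaryEncodeNat_eq_replicate, List.length_map]

/-- The total cost of the machine on `C` with parameter `r` (`ℓ = ellOf r n`). [folklore] -/
def totalCost (r m : ℕ) (C : Circuit (Fin n)) : ℕ :=
  let ℓ := ellOf r n
  let E := (orCodeList m C ℓ).map encodeNat
  headerCost (circuitCodeList m C).length (encodeNat n).length (encodeNat (wtag C.output)).length
      (encodeNat (wval C.output)).length (encodeNat C.size).length +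
    paramsCost r n C.size (Nat.log 2 n / r) ℓ +
    emitHeaderCost (n - ℓ) (2 ^ ℓ * (C.size + 2)) +
    ((10 * ℓ + 3) + (4 * ℓ + 1) + (2 * ℓ + 1)) +
    (2 ^ ℓ * (copyCost n C.size ℓ (2 ^ ℓ * (C.size + 2)) C.maxFanIn (gatesCode m C.gates).length + 2) + 1) +
    finalGateCost n C.size ℓ +
    ((3 * (outRev E).length + 1) + 1 + 1 + (4 * E.length + 1) +
      (2 * ((gatesCode m C.gates).length + (encodeNat (wtag C.output)).length + (encodeNat (wval C.output)).length +
        (encodeNat (C.size + 2)).length + (encodeNat ℓ).length + ℓ + (encodeNat (2 ^ ℓ * (C.size + 2))).length + ℓ) + 8))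

/-- **Semantics of the preprocessing machine.** Started on the file with `encodeAccCircuit m C`
on `inp` (all else empty), `preprocProg r` ends on the file with
`encodeAccCircuit m (C.orRestrictions (ellOf r n))` on `out` (all else empty) within
`totalCost r m C` steps. [cite: Williams2014, Thm. 4.1] -/
theorem runs_preprocProg {r : ℕ} (hr : 0 < r) (m : ℕ) (C : Circuit (Fin n)) :
    Runs (preprocProg r) (base { PRF.empty with inp := encodeAccCircuit m C }.regs)
      (base { PRF.empty with out := encodeAccCircuit m (C.orRestrictions (ellOf r n)) }.regs) (totalCost r m C) := by
  set ℓ := ellOf r n with hℓ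
  have hℓn : ℓ ≤ n := ellOf_le r n
  set σ₀ : PRF := { PRF.empty with inp := encodeAccCircuit m C } with hσ₀
  -- Phase 0
  set σ₁ : PRF := { PRF.empty with
    inp := gatesCode m C.gates, NN := encodeNat n, TO := encodeNat (wtag C.output), VO := encodeNat (wval C.output)
    SS := encodeNat C.size } with hσ₁
  have h1 : Runs headerProg (base σ₀.regs) (base σ₁.regs) (headerCost (circuitCodeList m C).length (encodeNat n).length
      (encodeNat (wtag C.output)).length (encodeNat (wval C.output)).length (encodeNat C.size).length) := by
    refine (runs_headerProg m C σ₀ (by simp [hσ₀]) (by simp [hσ₀]) (by simp [hσ₀]) (by simp [hσ₀]) (by simp [hσ₀])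
      (by simp [hσ₀]) (by simp [hσ₀])).of_eq ?_ le_rfl
    simp only [hσ₁, hσ₀, gatesCode, gateItems]
  -- Phase 1
  set σ₂ : PRF := { σ₁ with
    Eu := List.replicate ℓ true, EL := encodeNat ℓ, Lu := List.replicate (2 ^ ℓ) true, LN := encodeNat (2 ^ ℓ)
    SS := encodeNat (C.size + 2), G := encodeNat (2 ^ ℓ * (C.size + 2)), NN := encodeNat (n - ℓ) } with hσ₂
  have h2 : Runs (paramsProg r) (base σ₁.regs) (base σ₂.regs) (paramsCost r n C.size (Nat.log 2 n / r) ℓ) := by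
    refine (runs_paramsProg hr n C.size σ₁ (by simp [hσ₁]) (by simp [hσ₁]) (by simp [hσ₁]) (by simp [hσ₁]) (by simp [hσ₁])
      (by simp [hσ₁]) (by simp [hσ₁]) (by simp [hσ₁]) (by simp [hσ₁]) (by simp [hσ₁]) (by simp [hσ₁])
      (by simp [hσ₁])).of_eq ?_ le_rfl
    simp only [hσ₂, hℓ]
  -- Phase 2
  set E₀ := [encodeNat (n - ℓ), encodeNat 1, encodeNat (2 ^ ℓ * (C.size + 2)), encodeNat (2 ^ ℓ * (C.size + 2) + 1)] with hE₀
  set σ₃ : PRF := { σ₂ with o := outRev E₀, cnt := List.replicate E₀.length true, NN := [], G := [] } with hσ₃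
  have h3 : Runs emitHeaderProg (base σ₂.regs) (base σ₃.regs) (emitHeaderCost (n - ℓ) (2 ^ ℓ * (C.size + 2))) := by
    refine (runs_emitHeaderProg [] (n - ℓ) (2 ^ ℓ * (C.size + 2)) σ₂ (by simp [hσ₂, hσ₁]) (by simp [hσ₂]) (by simp [hσ₂])
      (by simp [hσ₂, hσ₁])).of_eq ?_ le_rfl
    simp only [hσ₃, hσ₂, hσ₁, hE₀, List.nil_append]; simp
  -- the word of the copy index
  set σ₄ : PRF := { σ₃ with AW := natToWord ℓ 0 } with hσ₄
  have h4 : Runs initWordProg (base σ₃.regs) (base σ₄.regs) ((10 * ℓ + 3) + (4 * ℓ + 1) + (2 * ℓ + 1)) :=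
    runs_initWordProg ℓ σ₃ (by simp [hσ₃, hσ₂]) (by simp [hσ₃, hσ₂, hσ₁]) (by simp [hσ₃, hσ₂, hσ₁]) (by simp [hσ₃, hσ₂, hσ₁])
  -- Phase 3
  set E₁ := E₀ ++ ((List.range' 0 (2 ^ ℓ)).flatMap (copyBlock m C ℓ)).map encodeNat with hE₁
  set σ₅ : PRF := { σ₄ with
    Lu := [], o := outRev E₁, cnt := List.replicate E₁.length true, A := encodeNat (2 ^ ℓ * (C.size + 2))
    AW := natToWord ℓ (2 ^ ℓ) } with hσ₅
  have h5 : Runs copiesProg (base σ₄.regs) (base σ₅.regs)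
      (2 ^ ℓ * (copyCost n C.size ℓ (2 ^ ℓ * (C.size + 2)) C.maxFanIn (gatesCode m C.gates).length + 2) + 1) := by
    refine (runs_copiesLoop (m := m) C (circuitOKK C) hℓn (2 ^ ℓ) 0 (by simp) E₀ σ₄ (by simp [hσ₄, hσ₃, hσ₂])
      (by simp [hσ₄, hσ₃, hσ₂, hσ₁]) (by simp [hσ₄, hσ₃, hσ₂, hσ₁]) (by simp [hσ₄, hσ₃, hσ₂, hσ₁])
      (by simp [hσ₄, hσ₃, hσ₂, hσ₁]) (by simp [hσ₄, hσ₃, hσ₂, hσ₁]) (by simp [hσ₄, hσ₃, hσ₂]) (by simp [hσ₄, hσ₃, hσ₂])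
      (by simp [hσ₄, hσ₃, hσ₂, hσ₁, encodeNat_zero]) (by simp [hσ₄]) (by simp [hσ₄, hσ₃]) (by simp [hσ₄, hσ₃])
      (by simp [hσ₄, hσ₃, hσ₂, hσ₁]) (by simp [hσ₄, hσ₃, hσ₂, hσ₁]) (by simp [hσ₄, hσ₃, hσ₂, hσ₁])
      (by simp [hσ₄, hσ₃, hσ₂, hσ₁]) (by simp [hσ₄, hσ₃, hσ₂, hσ₁])).of_eq ?_ le_rfl
    simp only [hσ₅, hσ₄, hE₁]
  -- Phase 4
  set E₂ := E₁ ++ [encodeNat (accCode m (GateFn.or (2 ^ ℓ))), encodeNat (2 ^ ℓ)] ++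
    ((List.range (2 ^ ℓ)).flatMap fun a => copyWire ℓ (a * (C.size + 2)) a C.output).map encodeNat with hE₂
  set σ₆ : PRF := { σ₅ with LN := [], o := outRev E₂, cnt := List.replicate E₂.length true } with hσ₆
  have h6 : Runs finalGateProg (base σ₅.regs) (base σ₆.regs) (finalGateCost n C.size ℓ) := by
    refine (runs_finalGateProg (m := m) C hℓn E₁ σ₅ (by simp [hσ₅, hσ₄, hσ₃, hσ₂]) (by simp [hσ₅, hσ₄, hσ₃, hσ₂])
      (by simp [hσ₅]) (by simp [hσ₅, hσ₄, hσ₃, hσ₂, hσ₁]) (by simp [hσ₅, hσ₄, hσ₃, hσ₂, hσ₁])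
      (by simp [hσ₅, hσ₄, hσ₃, hσ₂, hσ₁]) (by simp [hσ₅, hσ₄, hσ₃, hσ₂, hσ₁]) (by simp [hσ₅, hσ₄, hσ₃, hσ₂])
      (by simp [hσ₅, hσ₄, hσ₃, hσ₂]) (by simp [hσ₅]) (by simp [hσ₅]) (by simp [hσ₅]) (by simp [hσ₅])
      (by simp [hσ₅, hσ₄, hσ₃, hσ₂, hσ₁]) (by simp [hσ₅, hσ₄, hσ₃, hσ₂, hσ₁]) (by simp [hσ₅, hσ₄, hσ₃, hσ₂, hσ₁])
      (by simp [hσ₅, hσ₄, hσ₃, hσ₂, hσ₁]) (by simp [hσ₅, hσ₄, hσ₃, hσ₂, hσ₁]) (by simp [hσ₅, hσ₄, hσ₃, hσ₂, hσ₁])).of_eq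
      ?_ le_rfl
    simp only [hσ₆, hE₂]
  -- Phase 5
  have hE : E₂ = (orCodeList m C ℓ).map encodeNat := by
    rw [hE₂, hE₁, hE₀, ← List.range_eq_range']
    exact emitted_eq m C ℓ
  have h7 := runs_finishProg E₂ σ₆ (by simp [hσ₆]) (by simp [hσ₆]) (by simp [hσ₆, hσ₅, hσ₄, hσ₃, hσ₂, hσ₁])
  refine (h1.seq (h2.seq (h3.seq (h4.seq (h5.seq (h6.seq h7)))))).of_eq ?_ ?_
  · rw [encodeAccCircuit_orRestrictions, ← hE]
    simp only [hσ₆, hσ₅, hσ₄, hσ₃, hσ₂, hσ₁]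
    simp
  · simp only [hσ₆, hσ₅, hσ₄, hσ₃, hσ₂, hσ₁, totalCost]
    rw [← hℓ, ← hE]
    simp [natToWord]
    omega

/-! ### Compilation to `TM2` -/

/-- The initial file of a run is the machine's file with the input on `inp`. [folklore] -/
theorem init_inp_eq (x : List Bool) : Regs.init pinp x = base { PRF.empty with inp := x }.regs := by
  funext i
  rcases i with ((a | b) | c) | d
  · cases a <;> rfl
  · cases b <;> rfl
  · cases c <;> rfl
  · cases d <;> rfl

/-- The final file of a run is the machine's file with the output on `out`. [folklore] -/
theorem init_out_eq (x : List Bool) : Regs.init pout x = base { PRF.empty with out := x }.regs := by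
  funext i
  rcases i with ((a | b) | c) | d
  · cases a <;> rfl
  · cases b <;> rfl
  · cases c <;> rfl
  · cases d <;> rfl

/-- **The preprocessing machine as a `TM2` machine** (compiled by `StackMachinesTM2.lean`).
[cite: Williams2014, Thm. 4.1] -/
noncomputable def machine (r : ℕ) : Turing.TM2ComputableAux Bool Bool :=
  (Com.compile ((preprocProg r).map (Fintype.equivFin PReg))).toAux (Fintype.equivFin PReg pinp)
    (Fintype.equivFin PReg pout)

/-- The compiled machine prints the code of the OR of restrictions within `totalCost + 1`
steps. [cite: Williams2014, Thm. 4.1] -/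
theorem machine_outputsWithin {r : ℕ} (hr : 0 < r) (m : ℕ) (C : Circuit (Fin n)) :
    (machine r).OutputsWithin (encodeAccCircuit m C) (encodeAccCircuit m (C.orRestrictions (ellOf r n)))
      (totalCost r m C + 1) := by
  have h := runs_preprocProg hr m C
  rw [← init_inp_eq, ← init_out_eq] at h
  exact Com.outputsWithin_of_runs_equiv (Fintype.equivFin PReg) (Or.inl h)

/-! ### Sizes of the codes -/

/-- A sum of at most `B`-bounded terms. [folklore] -/
theorem sum_le_length_mul {l : List ℕ} {B : ℕ} (h : ∀ x ∈ l, x ≤ B) : l.sum ≤ l.length * B := by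
  induction l with
  | nil => simp
  | cons a l ih =>
    rw [List.sum_cons, List.length_cons, Nat.succ_mul]
    have := h a (by simp)
    have := ih fun x hx => h x (by simp [hx])
    omega

/-- The number of naturals in the codes of the gates: `Σ (2 + 2 kᵢ) ≤ s (2 K + 2)`. [folklore] -/
theorem length_flatMap_gateCodeList_le (m : ℕ) (C : Circuit (Fin n)) :
    (C.gates.flatMap (gateCodeList m)).length ≤ C.size * (2 * C.maxFanIn + 2) := by
  rw [List.length_flatMap, Circuit.size]
  have hK := (Circuit.maxFanIn_le_iff C C.maxFanIn).1 le_rfl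
  refine (sum_le_length_mul (B := 2 * C.maxFanIn + 2) fun x hx => ?_).trans (by rw [List.length_map])
  obtain ⟨g, hg, rfl⟩ := List.mem_map.1 hx
  have := hK g hg
  simp [gateCodeList, List.length_flatMap, Function.comp_def]
  omega

/-- The input code lists at most `4 + s (2 K + 2)` naturals. [folklore] -/
theorem length_circuitCodeList_le (m : ℕ) (C : Circuit (Fin n)) :
    (circuitCodeList m C).length ≤ 4 + C.size * (2 * C.maxFanIn + 2) := by
  have := length_flatMap_gateCodeList_le m C
  simp only [circuitCodeList, List.length_cons, List.length_append, length_wireCode]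
  omega

/-- The naturals in the codes of the gates are at most `n + s + K + 4`. [folklore] -/
theorem mem_flatMap_gateCodeList_le (m : ℕ) (C : Circuit (Fin n)) :
    ∀ x ∈ C.gates.flatMap (gateCodeList m), x ≤ n + C.size + C.maxFanIn + 4 := by
  intro x hx
  obtain ⟨g, hg, hx⟩ := List.mem_flatMap.1 hx
  have hOK := circuitOKK C g hg
  simp only [gateCodeList, List.mem_cons, List.mem_flatMap, List.mem_ofFn] at hx
  rcases hx with rfl | rfl | ⟨w, ⟨i, rfl⟩, hx⟩
  · have := accCode_le_four m g.fn; omega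
  · have := hOK.2; omega
  · have hw := hOK.1 i
    rcases hgi : g.args i with j | k <;> rw [hgi] at hx hw <;> simp [wireCode] at hx <;> rcases hx with rfl | rfl
    · omega
    · have := j.2; omega
    · omega
    · simp [WireOK] at hw; omega

/-- The work copy of the gate items has length `O(s K (n + s + K))`. [folklore] -/
theorem length_gatesCode_le (m : ℕ) (C : Circuit (Fin n)) :
    (gatesCode m C.gates).length ≤ C.size * (2 * C.maxFanIn + 2) * (2 * (n + C.size + C.maxFanIn + 4) + 2) := by
  rw [gatesCode, length_encList, List.map_map]
  refine (sum_le_length_mul (B := 2 * (n + C.size + C.maxFanIn + 4) + 2) fun x hx => ?_).trans ?_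
  · obtain ⟨y, hy, rfl⟩ := List.mem_map.1 hx
    have h1 := mem_flatMap_gateCodeList_le m C y hy
    have h2 := length_encodeNat_le_self y
    simp; omega
  · rw [List.length_map]
    exact Nat.mul_le_mul_right _ (length_flatMap_gateCodeList_le m C)

/-- The naturals of a re-addressed wire of copy `a < 2^ℓ` are at most `2^ℓ (s + 2) + n`.
[folklore] -/
theorem mem_copyWire_le {s ℓ a : ℕ} (ha : a < 2 ^ ℓ) (w : Fin n ⊕ ℕ) (hw : WireOK s w) :
    ∀ x ∈ copyWire ℓ (a * (s + 2)) a w, x ≤ 2 ^ ℓ * (s + 2) + n := by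
  have hA : a * (s + 2) + (s + 2) ≤ 2 ^ ℓ * (s + 2) := by rw [← Nat.succ_mul]; exact Nat.mul_le_mul_right _ ha
  intro x hx
  rcases w with i | j
  · simp only [copyWire] at hx
    split_ifs at hx <;> simp at hx <;> rcases hx with rfl | rfl
    · omega
    · cases a.testBit i <;> simp <;> omega
    · omega
    · have := i.2; omega
  · simp only [WireOK] at hw
    simp [copyWire] at hx; rcases hx with rfl | rfl <;> omega

/-- The output code lists `6 + 2^ℓ (6 + Σ (2 + 2 kᵢ)) ≤ 6 + 2^ℓ (6 + s (2 K + 2))` naturals. [folklore] -/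
theorem length_orCodeList_le (m : ℕ) (C : Circuit (Fin n)) (ℓ : ℕ) :
    (orCodeList m C ℓ).length ≤ 6 + 2 ^ ℓ * (6 + C.size * (2 * C.maxFanIn + 2)) := by
  have hb : ∀ a ∈ List.range (2 ^ ℓ), (copyBlock m C ℓ a).length ≤ 4 + C.size * (2 * C.maxFanIn + 2) := by
    intro a _
    have := length_flatMap_gateCodeList_le m C
    have e : (C.gates.flatMap (copyGate m ℓ (a * (C.size + 2)) a)).length = (C.gates.flatMap (gateCodeList m)).length := by
      simp only [List.length_flatMap]
      congr 1
      refine List.map_congr_left fun g _ => ?_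
      simp [copyGate, gateCodeList, List.length_flatMap]
    simp only [copyBlock, List.length_cons, e]; omega
  have h1 : ((List.range (2 ^ ℓ)).flatMap (copyBlock m C ℓ)).length ≤ 2 ^ ℓ * (4 + C.size * (2 * C.maxFanIn + 2)) := by
    rw [List.length_flatMap]
    refine (sum_le_length_mul fun x hx => ?_).trans (by rw [List.length_map, List.length_range])
    obtain ⟨a, ha, rfl⟩ := List.mem_map.1 hx
    exact hb a ha
  have h2 : ((List.range (2 ^ ℓ)).flatMap fun a => copyWire ℓ (a * (C.size + 2)) a C.output).length = 2 ^ ℓ * 2 := by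
    rw [List.length_flatMap]
    have : (List.range (2 ^ ℓ)).map (fun a => (copyWire ℓ (a * (C.size + 2)) a C.output).length) =
        (List.range (2 ^ ℓ)).map fun _ => 2 := List.map_congr_left fun a _ => by simp
    rw [this, List.map_const', List.sum_replicate, List.length_range, smul_eq_mul]
  simp only [orCodeList, List.length_cons, List.length_append, h2]
  nlinarith [h1]

/-- The naturals of the output code are at most `2^ℓ (s + 2) + n + K + 4`. [folklore] -/
theorem mem_orCodeList_le (m : ℕ) (C : Circuit (Fin n)) (ℓ : ℕ) :
    ∀ x ∈ orCodeList m C ℓ, x ≤ 2 ^ ℓ * (C.size + 2) + n + C.maxFanIn + 4 := by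
  have hL : 2 ^ ℓ ≤ 2 ^ ℓ * (C.size + 2) := Nat.le_mul_of_pos_right _ (by omega)
  intro x hx
  simp only [orCodeList, List.mem_cons, List.mem_append, List.mem_flatMap, List.mem_range] at hx
  rcases hx with rfl | rfl | rfl | rfl | ⟨a, ha, hx⟩ | rfl | rfl | ⟨a, ha, hx⟩
  · omega
  · omega
  · omega
  · omega
  · simp only [copyBlock, List.mem_cons, List.mem_flatMap] at hx
    rcases hx with rfl | rfl | rfl | rfl | ⟨g, hg, hx⟩
    · omega
    · omega
    · omega
    · omega
    · have hOK := circuitOKK C g hg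
      simp only [copyGate, List.mem_cons, List.mem_flatMap, List.mem_ofFn] at hx
      rcases hx with rfl | rfl | ⟨w, ⟨i, rfl⟩, hx⟩
      · have := accCode_le_four m g.fn; omega
      · have := hOK.2; omega
      · have := mem_copyWire_le ha (g.args i) (hOK.1 i) x hx; omega
  · have := accCode_le_four m (GateFn.or (2 ^ ℓ)); omega
  · omega
  · have := mem_copyWire_le ha C.output (wireOK_output C) x hx; omega

/-- The reversed output has length `Σ (2 |e| + 2)`. [folklore] -/
theorem length_outRev (E : List (List Bool)) : (outRev E).length = (E.map fun e => 2 * e.length + 2).sum := by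
  rw [← List.length_reverse, reverse_outRev, length_encList]

/-! ### The running time is polynomial in `Z = 2^ℓ (n + s + K + 2)` -/

/-- `wireCost = O(Z²)`. [folklore] -/
theorem wireCost_le {n s ℓ G Z : ℕ} (hn : n ≤ Z) (hs : s ≤ Z) (hℓ : ℓ ≤ Z) (hG : G ≤ Z) (hZ : 2 ≤ Z) :
    wireCost n s ℓ G ≤ 400 * Z ^ 2 := by
  have h1 : n * (16 * n + 21) ≤ 16 * Z ^ 2 + 21 * Z :=
    (Nat.mul_le_mul hn (by omega : 16 * n + 21 ≤ 16 * Z + 21)).trans (le_of_eq (by ring))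
  have hZ2 : 2 * Z ≤ Z ^ 2 := by nlinarith
  unfold wireCost; omega

/-- `wireStep = O(Z²)`. [folklore] -/
theorem wireStep_le {n s ℓ G Z : ℕ} (hn : n ≤ Z) (hs : s ≤ Z) (hℓ : ℓ ≤ Z) (hG : G ≤ Z) (hZ : 2 ≤ Z) :
    wireStep n s ℓ G ≤ 425 * Z ^ 2 := by
  have := wireCost_le hn hs hℓ hG hZ
  have hZ2 : 2 * Z ≤ Z ^ 2 := by nlinarith
  unfold wireStep; omega

/-- `gateCost = O(Z³)`. [folklore] -/
theorem gateCost_le {n s ℓ G K Z : ℕ} (hn : n ≤ Z) (hs : s ≤ Z) (hℓ : ℓ ≤ Z) (hG : G ≤ Z) (hK : K ≤ Z) (hZ : 2 ≤ Z) :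
    gateCost n s ℓ G K ≤ 460 * Z ^ 3 := by
  have h1 : K * (16 * K + 21) ≤ 16 * Z ^ 2 + 21 * Z :=
    (Nat.mul_le_mul hK (by omega : 16 * K + 21 ≤ 16 * Z + 21)).trans (le_of_eq (by ring))
  have h2 : K * (wireStep n s ℓ G + 2) ≤ 425 * Z ^ 3 + 2 * Z :=
    (Nat.mul_le_mul hK (Nat.add_le_add_right (wireStep_le hn hs hℓ hG hZ) 2)).trans (le_of_eq (by ring))
  have hZ2 : 2 * Z ≤ Z ^ 2 := by nlinarith
  have hZ3 : 2 * Z ^ 2 ≤ Z ^ 3 := by nlinarith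
  unfold gateCost; omega

/-- `copyCost = O(Z⁴)` when the work copy has length `≤ 15 Z³`. [folklore] -/
theorem copyCost_le {n s ℓ G K I Z : ℕ} (hn : n ≤ Z) (hs : s ≤ Z) (hℓ : ℓ ≤ Z) (hG : G ≤ Z) (hK : K ≤ Z)
    (hI : I ≤ 15 * Z ^ 3) (hZ : 2 ≤ Z) : copyCost n s ℓ G K I ≤ 560 * Z ^ 4 := by
  have h1 : s * gateCost n s ℓ G K ≤ 460 * Z ^ 4 :=
    (Nat.mul_le_mul hs (gateCost_le hn hs hℓ hG hK hZ)).trans (le_of_eq (by ring))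
  have hZ2 : 2 * Z ≤ Z ^ 2 := by nlinarith
  have hZ3 : 2 * Z ^ 2 ≤ Z ^ 3 := by nlinarith
  have hZ4 : 2 * Z ^ 3 ≤ Z ^ 4 := by nlinarith
  unfold copyCost; omega

/-- `outStep = O(Z²)`. [folklore] -/
theorem outStep_le {n s ℓ G Z : ℕ} (hn : n ≤ Z) (hs : s ≤ Z) (hℓ : ℓ ≤ Z) (hG : G ≤ Z) (hZ : 2 ≤ Z) :
    outStep n s ℓ G ≤ 500 * Z ^ 2 := by
  have := wireCost_le hn hs hℓ hG hZ
  have hZ2 : 2 * Z ≤ Z ^ 2 := by nlinarith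
  unfold outStep; omega

/-- `finalGateCost = O(Z³)`. [folklore] -/
theorem finalGateCost_le {n s ℓ Z : ℕ} (hn : n ≤ Z) (hs : s ≤ Z) (hℓ : ℓ ≤ Z) (h2 : 2 ^ ℓ ≤ Z)
    (hG : 2 ^ ℓ * (s + 2) ≤ Z) (hZ : 2 ≤ Z) : finalGateCost n s ℓ ≤ 520 * Z ^ 3 := by
  have h1 : ℓ * (7 * 2 ^ ℓ + 2 + 2) ≤ 7 * Z ^ 2 + 4 * Z :=
    (Nat.mul_le_mul hℓ (by omega : 7 * 2 ^ ℓ + 2 + 2 ≤ 7 * Z + 4)).trans (le_of_eq (by ring))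
  have h3 : 2 ^ ℓ * (outStep n s ℓ (2 ^ ℓ * (s + 2)) + 2) ≤ 500 * Z ^ 3 + 2 * Z :=
    (Nat.mul_le_mul h2 (Nat.add_le_add_right (outStep_le hn hs hℓ hG hZ) 2)).trans (le_of_eq (by ring))
  have hZ2 : 2 * Z ≤ Z ^ 2 := by nlinarith
  have hZ3 : 2 * Z ^ 2 ≤ Z ^ 3 := by nlinarith
  unfold finalGateCost; omega

/-- `paramsCost = O(Z²) + O(r Z)`. [folklore] -/
theorem paramsCost_le {r n s q ℓ Z : ℕ} (hn : n ≤ Z) (hs : s ≤ Z) (hℓ : ℓ ≤ Z) (h2ℓ : 2 ^ ℓ ≤ Z) (hq : q ≤ Z)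
    (h2q : 2 ^ q ≤ Z) (hZ : 2 ≤ Z) : paramsCost r n s q ℓ ≤ 5000 * Z ^ 2 + 3 * (r * Z ^ 2) := by
  have hbn := length_encodeNat_le_self n
  have hlog : Nat.log 2 n ≤ Z := (Nat.log_le_self 2 n).trans hn
  have h0 : Nat.log 2 n * (2 * r + 1) ≤ 2 * (r * Z ^ 2) + Z ^ 2 := by
    have hZZ : Z ≤ Z ^ 2 := by nlinarith
    calc Nat.log 2 n * (2 * r + 1) ≤ Z * (2 * r + 1) := Nat.mul_le_mul_right _ hlog
      _ ≤ Z ^ 2 * (2 * r + 1) := Nat.mul_le_mul_right _ hZZ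
      _ = 2 * (r * Z ^ 2) + Z ^ 2 := by ring
  have h1 : q * (7 * 2 ^ q + 3 + 2) ≤ 7 * Z ^ 2 + 5 * Z :=
    (Nat.mul_le_mul hq (by omega : 7 * 2 ^ q + 3 + 2 ≤ 7 * Z + 5)).trans (le_of_eq (by ring))
  have h2 : ℓ * (7 * 2 ^ ℓ + 2 + 2) ≤ 7 * Z ^ 2 + 4 * Z :=
    (Nat.mul_le_mul hℓ (by omega : 7 * 2 ^ ℓ + 2 + 2 ≤ 7 * Z + 4)).trans (le_of_eq (by ring))
  have h3 : 270 * (ℓ + s + 3) ^ 2 ≤ 4320 * Z ^ 2 := by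
    have : ℓ + s + 3 ≤ 4 * Z := by omega
    calc 270 * (ℓ + s + 3) ^ 2 ≤ 270 * (4 * Z) ^ 2 := Nat.mul_le_mul_left _ (Nat.pow_le_pow_left this 2)
      _ = 4320 * Z ^ 2 := by ring
  have hZ2 : 2 * Z ≤ Z ^ 2 := by nlinarith
  unfold paramsCost; omega

/-- `headerCost = O(Z²)`. [folklore] -/
theorem headerCost_le {len a b c d Z : ℕ} (hlen : len ≤ 5 * Z ^ 2) (ha : a ≤ Z) (hb : b ≤ 1) (hc : c ≤ 2 * Z)
    (hd : d ≤ Z) (hZ : 2 ≤ Z) : headerCost len a b c d ≤ 100 * Z ^ 2 := by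
  have hZ2 : 2 * Z ≤ Z ^ 2 := by nlinarith
  unfold headerCost; omega

/-- `emitHeaderCost = O(Z)`. [folklore] -/
theorem emitHeaderCost_le {N G Z : ℕ} (hN : N ≤ Z) (hG : G ≤ Z) (hZ : 2 ≤ Z) : emitHeaderCost N G ≤ 200 * Z := by
  have h1 := length_encodeNat_le_self N
  have h2 := length_encodeNat_le_self G
  have h3 := length_encodeNat_le_self (G + 1)
  unfold emitHeaderCost; omega

/-- The constant of the running time (depending on the root parameter `r` only). [folklore] -/
def cst (r : ℕ) : ℕ := 7000 + 3 * r

/-- **The running time**: `totalCost r m C + 1 ≤ cst r · Z⁵`, `Z = 2^ℓ (n + s + K + 2)`,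
`ℓ = ellOf r n`. [folklore] -/
theorem totalCost_le (r m : ℕ) (C : Circuit (Fin n)) :
    totalCost r m C + 1 ≤ cst r * (2 ^ ellOf r n * (n + C.size + C.maxFanIn + 2)) ^ 5 := by
  set ℓ := ellOf r n with hℓ
  set s := C.size with hs
  set K := C.maxFanIn with hK
  set Z := 2 ^ ℓ * (n + s + K + 2) with hZ
  have hL : 1 ≤ 2 ^ ℓ := Nat.one_le_two_pow
  have hZb : n + s + K + 2 ≤ Z := by rw [hZ]; exact Nat.le_mul_of_pos_left _ hL
  have hn : n ≤ Z := by omega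
  have hsZ : s ≤ Z := by omega
  have hKZ : K ≤ Z := by omega
  have hZ2 : 2 ≤ Z := by omega
  have h2ℓ : 2 ^ ℓ ≤ Z := by rw [hZ]; exact Nat.le_mul_of_pos_right _ (by omega)
  have hℓZ : ℓ ≤ Z := (Nat.lt_two_pow_self).le.trans h2ℓ
  have hℓn : ℓ ≤ n := ellOf_le r n
  have hG : 2 ^ ℓ * (s + 2) ≤ Z := by rw [hZ]; exact Nat.mul_le_mul_left _ (by omega)
  set q := Nat.log 2 n / r with hq
  have hqZ : q ≤ Z := ((Nat.div_le_self _ _).trans (Nat.log_le_self 2 n)).trans hn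
  have h2q : 2 ^ q ≤ Z := by
    have e : 2 ^ q = ℓ + 1 := by rw [hℓ, ellOf, ← hq]; have := Nat.one_le_two_pow (n := q); omega
    have : ℓ + 1 ≤ 2 ^ ℓ := Nat.lt_two_pow_self
    omega
  -- powers of `Z`
  have hZ12 : 2 * Z ≤ Z ^ 2 := by nlinarith
  have hZ23 : 2 * Z ^ 2 ≤ Z ^ 3 := by nlinarith
  have hZ34 : 2 * Z ^ 3 ≤ Z ^ 4 := by nlinarith
  have hZ45 : 2 * Z ^ 4 ≤ Z ^ 5 := by nlinarith
  -- sizes of the codes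
  have hsK : s * (2 * K + 2) ≤ 2 * Z ^ 2 + 2 * Z := (Nat.mul_le_mul hsZ (by omega : 2 * K + 2 ≤ 2 * Z + 2)).trans (le_of_eq (by ring))
  have hlen : (circuitCodeList m C).length ≤ 5 * Z ^ 2 := by
    have := length_circuitCodeList_le m C; rw [← hs, ← hK] at this; omega
  have hI : (gatesCode m C.gates).length ≤ 15 * Z ^ 3 := by
    have h := length_gatesCode_le m C
    rw [← hs, ← hK] at h
    have : s * (2 * K + 2) * (2 * (n + s + K + 4) + 2) ≤ (2 * Z ^ 2 + 2 * Z) * (5 * Z) :=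
      Nat.mul_le_mul hsK (by omega)
    nlinarith
  have hE : ((orCodeList m C ℓ).map encodeNat).length ≤ 6 * Z ^ 3 := by
    rw [List.length_map]
    have h := length_orCodeList_le m C ℓ
    rw [← hs, ← hK] at h
    have : 2 ^ ℓ * (6 + s * (2 * K + 2)) ≤ Z * (6 + (2 * Z ^ 2 + 2 * Z)) := Nat.mul_le_mul h2ℓ (by omega)
    nlinarith
  have hO : (outRev ((orCodeList m C ℓ).map encodeNat)).length ≤ 54 * Z ^ 4 := by
    rw [length_outRev, List.map_map]
    refine (sum_le_length_mul (B := 8 * Z + 2) fun x hx => ?_).trans ?_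
    · obtain ⟨y, hy, rfl⟩ := List.mem_map.1 hx
      have h1 := mem_orCodeList_le m C ℓ y hy
      have h2 := length_encodeNat_le_self y
      rw [← hs, ← hK] at h1
      simp only [Function.comp_apply]; omega
    · rw [List.length_map]
      have h := length_orCodeList_le m C ℓ
      rw [← hs, ← hK] at h
      have : (orCodeList m C ℓ).length * (8 * Z + 2) ≤ (6 + Z * (6 + (2 * Z ^ 2 + 2 * Z))) * (8 * Z + 2) :=
        Nat.mul_le_mul_right _ (h.trans (Nat.add_le_add_left (Nat.mul_le_mul h2ℓ (by omega)) 6))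
      nlinarith
  -- the phases
  have c0 : headerCost (circuitCodeList m C).length (encodeNat n).length (encodeNat (wtag C.output)).length
      (encodeNat (wval C.output)).length (encodeNat s).length ≤ 100 * Z ^ 2 :=
    headerCost_le hlen ((length_encodeNat_le_self n).trans hn) (length_wtag_le _)
      ((length_wval_le C.output (wireOK_output C)).trans (by rw [← hs]; omega)) ((length_encodeNat_le_self s).trans hsZ) hZ2
  have c1 : paramsCost r n s q ℓ ≤ 5000 * Z ^ 2 + 3 * (r * Z ^ 2) := paramsCost_le hn hsZ hℓZ h2ℓ hqZ h2q hZ2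
  have c2 : emitHeaderCost (n - ℓ) (2 ^ ℓ * (s + 2)) ≤ 200 * Z := emitHeaderCost_le (by omega) hG hZ2
  have c3 : 2 ^ ℓ * (copyCost n s ℓ (2 ^ ℓ * (s + 2)) K (gatesCode m C.gates).length + 2) ≤ 560 * Z ^ 5 + 2 * Z :=
    (Nat.mul_le_mul h2ℓ (Nat.add_le_add_right (copyCost_le hn hsZ hℓZ hG hKZ hI hZ2) 2)).trans (le_of_eq (by ring))
  have c4 : finalGateCost n s ℓ ≤ 520 * Z ^ 3 := finalGateCost_le hn hsZ hℓZ h2ℓ hG hZ2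
  have hbG := length_encodeNat_le_self (2 ^ ℓ * (s + 2))
  have hbℓ := length_encodeNat_le_self ℓ
  have hbs := length_encodeNat_le_self (s + 2)
  have hbt := length_wtag_le C.output
  have hbv := (length_wval_le C.output (wireOK_output C))
  rw [← hs] at hbv
  have hr5 : 3 * (r * Z ^ 2) ≤ 3 * (r * Z ^ 5) := by
    have : Z ^ 2 ≤ Z ^ 5 := Nat.pow_le_pow_right (by omega) (by norm_num)
    have := Nat.mul_le_mul_left r this
    omega
  have hfin : cst r * Z ^ 5 = 7000 * Z ^ 5 + 3 * (r * Z ^ 5) := by rw [cst]; ring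
  rw [hfin]
  simp only [totalCost, ← hℓ, ← hs, ← hK, ← hq]
  omega

/-! ### The parameter `ℓ` is within a factor `2` of the `r`-th root -/

/-- **The sandwich**: `ⁿ√n ≤ 2 ℓ + 2` and `ℓ ≤ ⁿ√n` for `ℓ = ellOf r n = 2^{⌊log₂ n⌋ / r} - 1`
(`r ≥ 1`). [folklore] -/
theorem ellOf_sandwich (r : ℕ) (hr : 0 < r) : ∃ K N₀ : ℕ, ∀ n, N₀ ≤ n →
    Nat.nthRoot r n ≤ K * ellOf r n + K ∧ ellOf r n ≤ K * Nat.nthRoot r n + K := by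
  refine ⟨2, 0, fun n _ => ?_⟩
  have hr' : r ≠ 0 := hr.ne'
  set t := Nat.log 2 n with ht
  set q := t / r with hq
  have hq1 : 1 ≤ 2 ^ q := Nat.one_le_two_pow
  have hℓ : ellOf r n = 2 ^ q - 1 := rfl
  constructor
  · -- `R < 2^(q+1)` since `n < 2^(t+1) ≤ 2^(r (q+1))`
    have h1 : n < 2 ^ (t + 1) := Nat.lt_pow_succ_log_self one_lt_two n
    have h2 : t + 1 ≤ r * (q + 1) := by
      have h := Nat.lt_div_mul_add (a := t) hr
      rw [← hq, Nat.mul_comm] at h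
      rw [Nat.mul_add, Nat.mul_one]
      exact h
    have h3 : n < (2 ^ (q + 1)) ^ r := by
      rw [← pow_mul, Nat.mul_comm]
      exact h1.trans_le (Nat.pow_le_pow_right two_pos h2)
    have h4 : Nat.nthRoot r n < 2 ^ (q + 1) := (Nat.nthRoot_lt_iff hr').2 h3
    rw [pow_succ] at h4
    omega
  · rcases Nat.eq_zero_or_pos n with rfl | hn
    · have : q = 0 := by rw [hq, ht]; simp
      rw [hℓ, this]; simp
    · have h1 : (2 ^ q) ^ r ≤ n := by
        rw [← pow_mul]
        calc 2 ^ (q * r) ≤ 2 ^ t := Nat.pow_le_pow_right two_pos (Nat.div_mul_le_self t r)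
          _ ≤ n := Nat.pow_log_le_self 2 hn.ne'
      have h2 : 2 ^ q ≤ Nat.nthRoot r n := (Nat.le_nthRoot_iff hr').2 h1
      omega

end PreprocP

/-! ### Theorem 4.1 and its polynomial-size corollary from Lemma 4.1 alone -/

open PreprocP in
/-- **The preprocessing machine of Williams' Theorem 4.1** (hypothesis `hP` of
`Williams2014_thm_4_1_of_machines` with `ℓ = ellOf`): for every modulus `m` and root parameter
`r ≥ 1` there is a multi-stack machine printing, from the code of a circuit `C` over
`accBasis m` on `n` inputs, the code of the OR of its `2^ℓ` restrictions to the first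
`ℓ = 2^{⌊log₂ n⌋ / r} - 1` inputs, in time polynomial in `2^ℓ (n + size + fan-in + 2)`
(Williams 2014, proof of Thm. 4.1: "`C'` … is obtained by producing `2^ℓ` copies of `C` …
taking the OR of these copies … in `2^ℓ · poly` time"). [cite: Williams2014, Thm. 4.1] -/
theorem Williams2014_preprocessing : ∀ m r : ℕ, 2 ≤ m → 0 < r →
    ∃ (cP : ℕ) (P : Turing.TM2ComputableAux Bool Bool), ∀ (n : ℕ) (C : Circuit (Fin n)), C.IsOver (accBasis m) →
      P.OutputsWithin (encodeAccCircuit m C) (encodeAccCircuit m (C.orRestrictions (ellOf r n)))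
        (cP * (2 ^ ellOf r n * (n + C.size + C.maxFanIn + 2)) ^ cP + cP) := by
  intro m r _ hr
  refine ⟨cst r, machine r, fun n C _ => (machine_outputsWithin hr m C).mono ((totalCost_le r m C).trans ?_)⟩
  set Z := 2 ^ ellOf r n * (n + C.size + C.maxFanIn + 2) with hZ
  have h1 : 1 ≤ Z := Nat.mul_pos (Nat.two_pow_pos _) (by omega)
  have hc : 5 ≤ cst r := by unfold cst; omega
  have h5 : Z ^ 5 ≤ Z ^ cst r := Nat.pow_le_pow_right h1 hc
  exact (Nat.mul_le_mul_left _ h5).trans (Nat.le_add_right _ _)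

/-- **Williams' Theorem 4.1 from Lemma 4.1 alone**: with the evaluation machine
(`Williams2014_lemma_4_2_strong`) and the preprocessing machine (`Williams2014_preprocessing`)
constructed, the ACC-SAT algorithm of Thm. 4.1 follows from the (algorithmic Beigel–Tarui)
conversion lemma `Williams2014_lemma_4_1`. [cite: Williams2014, Thm. 4.1] -/
theorem Williams2014_thm_4_1_of_lemma_4_1 (h41 : Williams2014_lemma_4_1) : Williams2014_thm_4_1 :=
  Williams2014_thm_4_1_of_machines h41 Williams2014_lemma_4_2_strong PreprocP.ellOf PreprocP.ellOf_sandwich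
    Williams2014_preprocessing

/-- **The polynomial-size ACC-SAT algorithm from Lemma 4.1 alone** (Williams 2014, p. 18: ACC
circuits of size `n^c` in `O(2ⁿ/2^{log² n})` time). [cite: Williams2014, Thm. 4.1 and p. 18] -/
theorem Williams2014_accSat_polysize_of_lemma_4_1 (h41 : Williams2014_lemma_4_1) :
    Williams2014_accSat_polysize :=
  Williams2014_accSat_polysize_of_thm_4_1 (Williams2014_thm_4_1_of_lemma_4_1 h41)

/-- Murray–Williams' Thm. 5.1 from Lemma 4.1 alone. [cite: Williams2014, Thm. 4.1] -/
theorem MurrayWilliams2018_thm_5_1_of_lemma_4_1 (h41 : Williams2014_lemma_4_1) :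
    MurrayWilliams2018_thm_5_1 :=
  MurrayWilliams2018_thm_5_1_of_thm_4_1 (Williams2014_thm_4_1_of_lemma_4_1 h41)

namespace PreprocP
end PreprocP

end Literature.Computability.Complexity
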